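import Literature.Geometry.Riemannian.HCenterSliceVolume
import Literature.Geometry.Riemannian.MetricFlowParabolicNeighborhoods
import Literature.Geometry.Riemannian.KernelNashEntropyW1Bound
import HarnessLib

/-!
# Volume of time-slices of `P*`-parabolic neighbourhoods (Bamler 2020a, §9.1, arXiv v1 Thm. 35)

R. Bamler, *Entropy and heat kernel bounds on a Ricci flow background*, arXiv:2008.07093 (2020a),
§9.1 (arXiv v1 Thm. 35, first display (9.8)): for `α > 0`, `A, T^± ≥ 0`, a point `(x₀, t₀)`
and a scale `r > 0` with `[t₀ − (T⁻ + α) r², t₀] ⊂ I`, every time-slice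
`S_t := P*(x₀, t₀; A r, −T⁻ r², T⁺ r²) ∩ (M × {t})` (display (9.7)) of the `P*`-parabolic
neighbourhood satisfies

  `|S_t|_t ≤ C(A, T⁻, T⁺, α) exp(𝒩_{x₀,t₀}(T⁻ r²)) rⁿ`.

This file LINKS the landed kernel-form core of the printed proof
(`exists_riemVolume_le_of_hCenters_near`, `HCenterSliceVolume.lean`: the volume of a measurable set
of points all of whose `H_m`-centres at the base time lie in a fixed ball) to the tree's metric-flow
vocabulary (`ricciFlowMetricFlow`, `MetricFlow.pParabolicNhd`, `MetricFlow.pParabolicNhdSlice`,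
`MetricFlow.IsHCenter`), exactly along the printed proof (§9.2, proof of Thm. 35):

* `MetricFlow.IsHCenter.edist_le_wassersteinW1_add` — the first display of the proof, in any
  metric flow: for `H`-centres `z₀` of `x₀ ∈ 𝒳_{t₀}` and `z` of `x ∈ 𝒳_t` in the slice `𝒳_s`,
  `d_s(z₀, z) = d_{W₁}(δ_{z₀}, δ_z) ≤ √(H(t₀ − s)) + d_{W₁}(ν_{x₀;s}, ν_{x;s}) + √(H(t − s))`
  (`W₁`-triangle inequality and `d_{W₁}(δ_z, ν_{x;s}) ≤ √(H(t − s))` at `H`-centres);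
* `MetricFlow.IsHConcentrated.isOpen_setOf_wassersteinW1_condKernel_lt`,
  `MetricFlow.IsHConcentrated.isOpen_pParabolicNhdSlice` — in an `H`-concentrated flow the
  time-slices `S_t` are open (`x ↦ d_{W₁}(μ, ν_{x;s})` is `1`-Lipschitz, since
  `d_{W₁}(ν_{x;s}, ν_{y;s}) ≤ d_t(x, y)`), hence Borel measurable;
* `kernelNashEntropy_le_of_lintegral_edist_sq_le` — the entropy step of the proof
  ("since `d_{W₁}(δ_{z₀}, ν_{x₀,t₀}(s₀)) ≤ √(H_n (t₀ − s₀))` we can use Cor. 5.11 to deduce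
  `𝒩*_{s₁}(z₀, s₀) ≤ 𝒩*_{s₁}(x₀, t₀) + C`"): for a point `z₀` with
  `∫ d_{s₀}²(z₀, ·) dν_{x₀,t₀;s₀} ≤ V`,
  `𝒩*_{s₁}(z₀, s₀) ≤ 𝒩*_{s₁}(x₀, t₀) + (m/2) log((t₀ − s₁)/(s₀ − s₁)) + √(m/(2(s₀ − s₁)) − R_min) √V`
  (Cor. 5.11 `IsRicciFlow.ofReal_kernelNashEntropy_sub_sub_le_mul_wassersteinW1` at `t* = s₀`
  against `ν_{z₀,s₀;s₀} = δ_{z₀}`, and `d_{W₁}(δ_{z₀}, ν) ≤ √Var(δ_{z₀}, ν) ≤ √V`);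
* `exists_riemVolume_pParabolicNhdSlice_le` — **the theorem**: for `m ≥ 3`, `Λ ≥ 0`, `T⁻ ≥ 0`,
  `α > 0` and any `A, T⁺` there is `C = C(m, Λ, A, T⁻, T⁺, α) > 0` such that for every Ricci
  flow `hflow` on `[a, T]` of a smooth family of Riemannian metrics on a closed connected manifold
  modelled on `ℝᵐ`, with metric flow `𝒳 = ricciFlowMetricFlow hh hR _ hflow`, all `x₀ ∈ M`,
  `t₀, t ∈ [a, T]`, `r > 0` with `a < s₁ := t₀ − (T⁻ + α) r²`, base time
  `s₀ := t₀ − T⁻ r² < T`, and `R ≥ R_min` on `M × [s₁, t]` with `−R_min (t − s₁) ≤ Λ`,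

    `|𝒳.pParabolicNhdSlice (x₀, t₀) (A r) (T⁻ r²) (T⁺ r²) t|_{g_t} ≤ C rᵐ exp(𝒩*_{s₁}(x₀, t₀))`,

  i.e. (9.8) with the entropy taken at the earlier time `s₁ = t₀ − (T⁻ + α) r² ≤ s₀` (which is
  stronger: `s ↦ 𝒩*_s(x₀, t₀)` is non-decreasing, `kernelNashEntropy_mono`, Prop. 5.2) and with
  the global lower scalar curvature bound of the source's §9 made explicit through `Λ`. Proof as
  printed: an `H_m`-centre `z₀` of `(x₀, t₀)` at `s₀` (`IsHConcentrated.exists_isHCenter`,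
  `ricciFlowMetricFlow_isHConcentrated`); every `x ∈ S_t` has an `H_m`-centre `z` at `s₀` with
  `d_{s₀}(z₀, z) < (2√(H_m Θ) + max(A,0)/√α) ρ`, `ρ = √(s₀ − s₁) = √α r`,
  `Θ = (T⁻ + max(T⁺,0))/α + 1`; the core gives `|S_t|_t ≤ C₀ ρᵐ exp(𝒩*_{s₁}(z₀, s₀))` for
  `t > s₀` (for `t = s₀`, `S_{s₀} ⊆ B_{s₀}(z₀, A₁ ρ)` and Thm. 8.1
  `exists_riemVolume_ball_le_exp_pointedNashEntropy` is used directly; for `t < s₀` the slice is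
  empty), and the entropy step moves `𝒩*` from `(z₀, s₀)` to `(x₀, t₀)`;
* `exists_riemVolume_pParabolicNhdSlice_le_exp_kernelNashEntropy_baseTime` — (9.8) as printed,
  with `exp(𝒩_{x₀,t₀}(T⁻ r²))`, for `T⁻ > 0` (by `kernelNashEntropy_mono`).

Everything is proved; no definitions, no named facts. What is NOT here: the second display of
Thm. 35 (the `A' r`-neighbourhood of `S_t`) and the covering theorem (arXiv v1 Thm. 36).

## References

* R. H. Bamler, *Entropy and heat kernel bounds on a Ricci flow background*, arXiv:2008.07093
  (2020), §9.1, Def. 9.1, (9.7), arXiv v1 Thm. 35, (9.8), and its proof in §9.2; §5.1,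
  Cor. 5.11; §8, Thm. 8.1. [Bamler2020Entropy]
* R. H. Bamler, *Compactness theory of the space of super Ricci flows*, Invent. Math. 233 (2023),
  1121–1277, §3.4 (`H`-centres), §3.5 (`P*`-parabolic neighbourhoods). [Bamler2023]
-/

noncomputable section

open Set Filter Function MeasureTheory Measure
open scoped Manifold ContDiff Topology ENNReal NNReal

namespace Literature.Geometry.Riemannian

open Lorentzian Lorentzian.PseudoRiemannianMetric

/-! ### Metric-flow lemmas: `H`-centres of `W₁`-close points, openness of the time-slices -/

namespace MetricFlow

universe u

variable {I : Set ℝ} {𝒳 : MetricFlow.{u} I} {H : ℝ}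

/-- **Distance between `H`-centres of two points in terms of the `W₁`-distance of their conjugate
heat kernels** (Bamler 2020a, §9.2, proof of arXiv v1 Thm. 35, first display:
"`d_0(z₀, z) = d_{W₁}(δ_{z₀}, δ_z) ≤ d_{W₁}(δ_{z₀}, ν_{x₀,t₀;0}) + d_{W₁}(ν_{x₀,t₀;0}, ν_{x,t;0})
+ d_{W₁}(ν_{x,t;0}, δ_z) ≤ √(H_n t₀) + A + √(H_n t)`"), in any metric flow: for an `H`-centre
`z₀ ∈ 𝒳_s` of `x₀ ∈ 𝒳_{t₀}` and an `H`-centre `z ∈ 𝒳_s` of `x ∈ 𝒳_t`,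
`d_s(z₀, z) ≤ √(H(t₀ − s)) + d_{W₁}(ν_{x₀;s}, ν_{x;s}) + √(H(t − s))`.
[cite: Bamler2020Entropy, §9.2, proof of arXiv v1 Thm. 35, first display] -/
theorem IsHCenter.edist_le_wassersteinW1_add {s t₀ t : I} {x₀ : 𝒳.Slice t₀} {x : 𝒳.Slice t}
    {z₀ z : 𝒳.Slice s} (hz₀ : 𝒳.IsHCenter H z₀ x₀) (hz : 𝒳.IsHCenter H z x) :
    edist z₀ z ≤ (ENNReal.ofReal (H * ((t₀ : ℝ) - s))) ^ (1 / 2 : ℝ) +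
      wassersteinW1 (𝒳.condKernel x₀ s) (𝒳.condKernel x s) +
        (ENNReal.ofReal (H * ((t : ℝ) - s))) ^ (1 / 2 : ℝ) := by
  haveI := 𝒳.isProbabilityMeasure_condKernel x₀ hz₀.1
  haveI := 𝒳.isProbabilityMeasure_condKernel x hz.1
  rw [← wassersteinW1_dirac_dirac]
  calc wassersteinW1 (Measure.dirac z₀) (Measure.dirac z)
      ≤ wassersteinW1 (Measure.dirac z₀) (𝒳.condKernel x₀ s) +
          wassersteinW1 (𝒳.condKernel x₀ s) (Measure.dirac z) := wassersteinW1_triangle _ _ _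
    _ ≤ wassersteinW1 (Measure.dirac z₀) (𝒳.condKernel x₀ s) +
          (wassersteinW1 (𝒳.condKernel x₀ s) (𝒳.condKernel x s) +
            wassersteinW1 (𝒳.condKernel x s) (Measure.dirac z)) :=
        add_le_add le_rfl (wassersteinW1_triangle _ _ _)
    _ ≤ (ENNReal.ofReal (H * ((t₀ : ℝ) - s))) ^ (1 / 2 : ℝ) +
          (wassersteinW1 (𝒳.condKernel x₀ s) (𝒳.condKernel x s) +
            (ENNReal.ofReal (H * ((t : ℝ) - s))) ^ (1 / 2 : ℝ)) := by
        refine add_le_add hz₀.wassersteinW1_dirac_le (add_le_add le_rfl ?_)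
        rw [wassersteinW1_comm]
        exact hz.wassersteinW1_dirac_le
    _ = _ := (add_assoc _ _ _).symm

/-- **`x ↦ d_{W₁}(μ, ν_{x;s})` has open strict sublevel sets on `𝒳_t`** (`s ≤ t`) in an
`H`-concentrated metric flow: it is `1`-Lipschitz, as
`d_{W₁}(μ, ν_{y;s}) ≤ d_{W₁}(μ, ν_{x;s}) + d_{W₁}(ν_{x;s}, ν_{y;s}) ≤ d_{W₁}(μ, ν_{x;s}) + d_t(x, y)`
(Bamler 2023, §3.2, Proposition (c): `d_{W₁}(ν_{x;s}, ν_{y;s}) ≤ d_t(x, y)`).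
[cite: Bamler2023, §3.2, Proposition (comparing two conjugate heat flows) (c)] -/
theorem IsHConcentrated.isOpen_setOf_wassersteinW1_condKernel_lt (hH : 𝒳.IsHConcentrated H)
    {s t : I} (hst : (s : ℝ) ≤ t) (μ : Measure (𝒳.Slice s)) [IsProbabilityMeasure μ]
    (c : ℝ≥0∞) : IsOpen {x : 𝒳.Slice t | wassersteinW1 μ (𝒳.condKernel x s) < c} := by
  rw [EMetric.isOpen_iff]
  intro x hx
  rw [mem_setOf_eq] at hx
  refine ⟨c - wassersteinW1 μ (𝒳.condKernel x s), tsub_pos_iff_lt.2 hx, fun y hy ↦ ?_⟩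
  rw [Metric.mem_eball'] at hy
  rw [mem_setOf_eq]
  haveI := 𝒳.isProbabilityMeasure_condKernel y hst
  have hW : wassersteinW1 μ (𝒳.condKernel x s) ≠ ⊤ := ne_top_of_lt hx
  calc wassersteinW1 μ (𝒳.condKernel y s)
      ≤ wassersteinW1 μ (𝒳.condKernel x s) +
          wassersteinW1 (𝒳.condKernel x s) (𝒳.condKernel y s) := wassersteinW1_triangle _ _ _
    _ ≤ wassersteinW1 μ (𝒳.condKernel x s) + edist x y :=
        add_le_add le_rfl (hH.wassersteinW1_condKernel_le_edist hst x y)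
    _ < wassersteinW1 μ (𝒳.condKernel x s) + (c - wassersteinW1 μ (𝒳.condKernel x s)) :=
        ENNReal.add_lt_add_left hW hy
    _ = c := add_tsub_cancel_of_le hx.le

/-- **The time-slices `S_t = P*(x₀; A, −T⁻, T⁺) ∩ 𝒳_t` are open** in an `H`-concentrated metric
flow (`T⁻ ≥ 0`): `S_t` is empty unless `t ∈ [𝔱(x₀) − T⁻, 𝔱(x₀) + T⁺]`, and then it is the strict
sublevel set `{d_{W₁}(ν_{x₀;𝔱(x₀)−T⁻}, ν_{·;𝔱(x₀)−T⁻}) < A}` of a `1`-Lipschitz function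
(Bamler 2020a, (9.7); Bamler 2023, §3.2, Proposition (c)). [cite: Bamler2020Entropy, §9.1, (9.7)] -/
theorem IsHConcentrated.isOpen_pParabolicNhdSlice (hH : 𝒳.IsHConcentrated H) (x₀ : 𝒳.Pt)
    (A : ℝ) {Tm : ℝ} (Tp : ℝ) (hTm : 0 ≤ Tm) (h : (x₀.1 : ℝ) - Tm ∈ I) (t : I) :
    IsOpen (𝒳.pParabolicNhdSlice x₀ A Tm Tp h t) := by
  by_cases ht : (x₀.1 : ℝ) - Tm ≤ t ∧ (t : ℝ) ≤ x₀.1 + Tp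
  · haveI := 𝒳.isProbabilityMeasure_condKernel (s := ⟨(x₀.1 : ℝ) - Tm, h⟩) x₀.2
      (show (x₀.1 : ℝ) - Tm ≤ x₀.1 by linarith)
    have e : 𝒳.pParabolicNhdSlice x₀ A Tm Tp h t =
        {y : 𝒳.Slice t | wassersteinW1 (𝒳.condKernel x₀.2 ⟨(x₀.1 : ℝ) - Tm, h⟩)
          (𝒳.condKernel y ⟨(x₀.1 : ℝ) - Tm, h⟩) < ENNReal.ofReal A} := by
      ext y
      rw [mem_pParabolicNhdSlice_iff, mem_setOf_eq]
      exact ⟨fun hy ↦ hy.2, fun hy ↦ ⟨ht, hy⟩⟩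
    rw [e]
    exact hH.isOpen_setOf_wassersteinW1_condKernel_lt ht.1 _ _
  · have e : 𝒳.pParabolicNhdSlice x₀ A Tm Tp h t = ∅ :=
      eq_empty_of_forall_notMem fun y hy ↦ ht hy.1
    rw [e]
    exact isOpen_empty

/-- The time-slices `S_t` of a `P*`-parabolic neighbourhood (`T⁻ ≥ 0`) are Borel measurable in
`𝒳_t` (they are open, `IsHConcentrated.isOpen_pParabolicNhdSlice`).
[cite: Bamler2020Entropy, §9.1, (9.7)] -/
theorem IsHConcentrated.measurableSet_pParabolicNhdSlice (hH : 𝒳.IsHConcentrated H)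
    (x₀ : 𝒳.Pt) (A : ℝ) {Tm : ℝ} (Tp : ℝ) (hTm : 0 ≤ Tm) (h : (x₀.1 : ℝ) - Tm ∈ I) (t : I) :
    MeasurableSet (𝒳.pParabolicNhdSlice x₀ A Tm Tp h t) :=
  (hH.isOpen_pParabolicNhdSlice x₀ A Tp hTm h t).measurableSet

end MetricFlow

/-! ### Two elementary inequalities -/

/-- `(H τ)^{1/2} ≤ √(H Θ) ρ` in `ℝ≥0∞` whenever `0 ≤ τ ≤ Θ ρ²` (`H, ρ ≥ 0`): the form in which the
radii `√(H_m (t − s₀))` of the proof of Thm. 35 are bounded by multiples of `ρ = √(s₀ − s₁)`.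
[folklore] -/
theorem ofReal_mul_rpow_half_le_ofReal_sqrt_mul {H τ Θ ρ : ℝ} (hH : 0 ≤ H) (hτ : 0 ≤ τ)
    (hρ : 0 ≤ ρ) (h : τ ≤ Θ * ρ ^ 2) :
    (ENNReal.ofReal (H * τ)) ^ (1 / 2 : ℝ) ≤ ENNReal.ofReal (Real.sqrt (H * Θ) * ρ) := by
  rw [ENNReal.ofReal_rpow_of_nonneg (mul_nonneg hH hτ) (by norm_num), ← Real.sqrt_eq_rpow]
  refine ENNReal.ofReal_le_ofReal ?_
  calc Real.sqrt (H * τ) ≤ Real.sqrt (H * Θ * ρ ^ 2) := by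
        refine Real.sqrt_le_sqrt ?_
        have := mul_le_mul_of_nonneg_left h hH
        linarith only [this]
    _ = Real.sqrt (H * Θ) * ρ := by rw [Real.sqrt_mul' _ (sq_nonneg ρ), Real.sqrt_sq hρ]

/-- `(r²)^{m/2} = rᵐ` for `r ≥ 0`. [folklore] -/
theorem sq_rpow_natCast_div_two {r : ℝ} (hr : 0 ≤ r) (m : ℕ) :
    (r ^ 2) ^ ((m : ℝ) / 2) = r ^ m := by
  rw [← Real.rpow_natCast r 2, ← Real.rpow_mul hr, ← Real.rpow_natCast]
  congr 1
  push_cast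
  ring

/-! ### The entropy at an `H_m`-centre -/

section Entropy

variable {m : ℕ} {M : Type*} [TopologicalSpace M] [ChartedSpace (EuclideanSpace ℝ (Fin m)) M]
  [IsManifold 𝓘(ℝ, EuclideanSpace ℝ (Fin m)) ∞ M] [T2Space M] [CompactSpace M]
  [SecondCountableTopology M] [MeasurableSpace M] [BorelSpace M] [ConnectedSpace M]
  {h : ℝ → PseudoRiemannianMetric 𝓘(ℝ, EuclideanSpace ℝ (Fin m)) ∞ (EuclideanSpace ℝ (Fin m))
    (TangentSpace 𝓘(ℝ, EuclideanSpace ℝ (Fin m)) : M → Type _)}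
  {cov : ℝ → CovariantDerivative 𝓘(ℝ, EuclideanSpace ℝ (Fin m)) (EuclideanSpace ℝ (Fin m))
    (TangentSpace 𝓘(ℝ, EuclideanSpace ℝ (Fin m)) : M → Type _)}
  {a T : ℝ} (hflow : IsRicciFlow h cov (Icc a T)) (hh : IsContMDiffFamilyOn ∞ h univ)
  (hR : ∀ r, (h r).IsRiemannian)

/-- **The pointed Nash entropy based at a point near an `H`-centre is controlled by the entropy at
the original point** (Bamler 2020a, §9.2, proof of arXiv v1 Thm. 35: "since
`d_{W₁}^{g_0}(δ_{z₀}, ν_{x₀,t₀}(0)) ≤ √(H_n t₀)`, we can use Proposition 5.2 and Corollary 5.11 to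
deduce that `𝒩_{z₀,0}(…) ≤ 𝒩_{x₀,t₀}(…) + C`"). For a Ricci flow on `[a, T]` of a smooth family of
Riemannian metrics on a closed connected manifold modelled on `ℝᵐ` (`m ≥ 3`), times
`a < s₁ < s₀ ≤ t₀ ≤ T` with `s₀ < T`, `R_{g_{s₁}} ≥ R_min`, and points `x₀, z₀` with
`∫ d_{s₀}²(z₀, ·) dν_{x₀,t₀;s₀} ≤ V` (e.g. an `H_m`-centre of `(x₀, t₀)`, `V = H_m (t₀ − s₀)`),

  `𝒩*_{s₁}(z₀, s₀) ≤ 𝒩*_{s₁}(x₀, t₀) + (m/2) log((t₀ − s₁)/(s₀ − s₁)) + √(m/(2(s₀ − s₁)) − R_min) √V`: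

Cor. 5.11 (`IsRicciFlow.ofReal_kernelNashEntropy_sub_sub_le_mul_wassersteinW1`) at `t* = s₀` for
`(x₁,t₁) = (z₀,s₀)`, `(x₂,t₂) = (x₀,t₀)`, with `ν_{z₀,s₀;s₀} = δ_{z₀}` and
`d_{W₁}(δ_{z₀}, ν_{x₀,t₀;s₀}) ≤ √Var(δ_{z₀}, ν_{x₀,t₀;s₀}) ≤ √V`.
[cite: Bamler2020Entropy, §9.2, proof of arXiv v1 Thm. 35; §5.1, Cor. 5.11] -/
theorem kernelNashEntropy_le_of_lintegral_edist_sq_le (hm : 3 ≤ m) {s₁ s₀ t₀ : ℝ} (has : a < s₁)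
    (hs₁₀ : s₁ < s₀) (hs₀t₀ : s₀ ≤ t₀) (hs₀T : s₀ < T) (ht₀T : t₀ ≤ T) {Rmin : ℝ}
    (hRmin : ∀ y : M, Rmin ≤ (h s₁).scalarCurvatureWith (cov s₁) y) (x₀ z₀ : M) {V : ℝ}
    (hV : 0 ≤ V)
    (hvar : ∫⁻ w, (h s₀).edist (hR s₀) z₀ w ^ 2 ∂(heatKernelMeasure hh hR t₀ x₀ s₀) ≤
      ENNReal.ofReal V) :
    pointedNashEntropy h (fun r y ↦ hflow.heatKernelFn hh hR s₀ z₀ (y, r)) m s₀ s₁ ≤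
      pointedNashEntropy h (fun r y ↦ hflow.heatKernelFn hh hR t₀ x₀ (y, r)) m t₀ s₁ +
        (m : ℝ) / 2 * Real.log ((t₀ - s₁) / (s₀ - s₁)) +
        Real.sqrt ((m : ℝ) / (2 * (s₀ - s₁)) - Rmin) * Real.sqrt V := by
  classical
  set L : ℝ := Real.sqrt ((m : ℝ) / (2 * (s₀ - s₁)) - Rmin) with hL
  have hL0 : 0 ≤ L := Real.sqrt_nonneg _
  -- Cor. 5.11 at `t* = s₀`, `(x₁,t₁) := (z₀,s₀)`, `(x₂,t₂) := (x₀,t₀)`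
  have hcor := hflow.ofReal_kernelNashEntropy_sub_sub_le_mul_wassersteinW1 hh hR hm has hs₁₀
    le_rfl hs₀t₀ hs₀T ht₀T hRmin z₀ x₀
  rw [heatKernelMeasure_self] at hcor
  -- `d_{W₁}(δ_{z₀}, ν) ≤ √Var(δ_{z₀}, ν) ≤ √V`
  letI : MetricSpace M := (h s₀).metricSpace (hR s₀)
  set ν : Measure M := heatKernelMeasure hh hR t₀ x₀ s₀ with hν
  have hW : wassersteinW1 (Measure.dirac z₀) ν ≤ ENNReal.ofReal (Real.sqrt V) := by
    refine (wassersteinW1_le_sqrt_variance (Measure.dirac z₀) ν).trans ?_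
    rw [variance_dirac_left, Real.sqrt_eq_rpow, ← ENNReal.ofReal_rpow_of_nonneg hV
      (by norm_num)]
    exact ENNReal.rpow_le_rpow hvar (by norm_num)
  have hc := hcor.trans (mul_le_mul' le_rfl hW)
  rw [← ENNReal.ofReal_mul hL0, ENNReal.ofReal_le_ofReal_iff (by positivity)] at hc
  linarith only [hc]

end Entropy

/-! ### The volume bound -/

/-- **Bamler 2020a, §9.1, arXiv v1 Thm. 35, (9.8): volume of time-slices of `P*`-parabolic
neighbourhoods.** For `m ≥ 3`, `Λ ≥ 0`, `T⁻ ≥ 0`, `α > 0` and any `A, T⁺` there is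
`C = C(m, Λ, A, T⁻, T⁺, α) > 0` such that: for every Ricci flow `hflow = (h, cov)` on `[a, T]` of a
smooth family of Riemannian metrics on a closed connected manifold modelled on `ℝᵐ`, with metric
flow `𝒳 = ricciFlowMetricFlow hh hR _ hflow` (slices `(M, d_{g_t})`, conjugate heat kernels
`ν_{x,t;s}`), all `t₀, t ∈ [a, T]`, scales `r > 0` with `a < s₁ := t₀ − (T⁻ + α) r²` and base time
`s₀ := t₀ − T⁻ r² < T`, every `R_min` with `R ≥ R_min` on `M × [s₁, t]` and `−R_min (t − s₁) ≤ Λ`,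
and every `x₀ ∈ M`, the time-`t` slice
`S_t = {x | d^{g_{s₀}}_{W₁}(ν_{x₀,t₀;s₀}, ν_{x,t;s₀}) < A r}` (`t ∈ [s₀, t₀ + T⁺ r²]`, else `∅`) of
`P*(x₀, t₀; A r, −T⁻ r², T⁺ r²)` satisfies

  `|S_t|_{g_t} ≤ C rᵐ exp(𝒩*_{s₁}(x₀, t₀))`,

`𝒩*_{s₁}(x₀,t₀) = 𝒩_{x₀,t₀}((T⁻ + α) r²)` the pointed Nash entropy of the conjugate heat kernel based
at `(x₀, t₀)` — display (9.8), with the entropy at the earlier time `s₁ ≤ s₀` (stronger, by the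
monotonicity Prop. 5.2) and the source's standing lower scalar curvature bound made explicit.
Proof (§9.2): `H_m`-centres `z₀` of `(x₀,t₀)` and `z` of `(x,t) ∈ S_t` at time `s₀` satisfy
`d_{s₀}(z₀, z) < √(H_m T⁻) r + A r + √(H_m (T⁻ + T⁺)) r`
(`MetricFlow.IsHCenter.edist_le_wassersteinW1_add`); the core
`exists_riemVolume_le_of_hCenters_near` ((9.10)–(9.11) and Thm. 8.1) bounds `|S_t|_t` by
`C₀ (s₀ − s₁)^{m/2} exp(𝒩*_{s₁}(z₀, s₀))` (for `t = s₀` one has `S_{s₀} ⊆ B_{s₀}(z₀, A₁ √(s₀ − s₁))`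
and Thm. 8.1 `exists_riemVolume_ball_le_exp_pointedNashEntropy` applies directly), and
`kernelNashEntropy_le_of_lintegral_edist_sq_le` (Cor. 5.11) moves the entropy to `(x₀, t₀)`.
[cite: Bamler2020Entropy, §9.1, arXiv v1 Thm. 35, (9.8); §9.2, proof of Thm. 35] -/
theorem exists_riemVolume_pParabolicNhdSlice_le (m : ℕ) (hm : 3 ≤ m) (A Tp : ℝ) {Λ Tm α : ℝ}
    (hΛ : 0 ≤ Λ) (hTm : 0 ≤ Tm) (hα : 0 < α) :
    ∃ C : ℝ, 0 < C ∧ ∀ {M : Type*} [TopologicalSpace M]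
      [ChartedSpace (EuclideanSpace ℝ (Fin m)) M]
      [IsManifold 𝓘(ℝ, EuclideanSpace ℝ (Fin m)) ∞ M] [T2Space M] [CompactSpace M]
      [SecondCountableTopology M] [MeasurableSpace M] [BorelSpace M] [ConnectedSpace M]
      {h : ℝ → PseudoRiemannianMetric 𝓘(ℝ, EuclideanSpace ℝ (Fin m)) ∞ (EuclideanSpace ℝ (Fin m))
        (TangentSpace 𝓘(ℝ, EuclideanSpace ℝ (Fin m)) : M → Type _)}
      {cov : ℝ → CovariantDerivative 𝓘(ℝ, EuclideanSpace ℝ (Fin m)) (EuclideanSpace ℝ (Fin m))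
        (TangentSpace 𝓘(ℝ, EuclideanSpace ℝ (Fin m)) : M → Type _)}
      {a T : ℝ} (hflow : IsRicciFlow h cov (Icc a T)) (hh : IsContMDiffFamilyOn ∞ h univ)
      (hR : ∀ r, (h r).IsRiemannian),
      ∀ {t₀ t r : ℝ} (ht₀ : t₀ ∈ Icc a T) (ht : t ∈ Icc a T) (hb : t₀ - Tm * r ^ 2 ∈ Icc a T),
      0 < r → a < t₀ - (Tm + α) * r ^ 2 → t₀ - Tm * r ^ 2 < T →
      ∀ {Rmin : ℝ}, (∀ s ∈ Icc (t₀ - (Tm + α) * r ^ 2) t, ∀ z : M,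
        Rmin ≤ (h s).scalarCurvatureWith (cov s) z) →
      -Rmin * (t - (t₀ - (Tm + α) * r ^ 2)) ≤ Λ → ∀ x₀ : M,
      (h t).riemVolume.real
          ((ricciFlowMetricFlow hh hR Set.ordConnected_Icc hflow).pParabolicNhdSlice
            ⟨⟨t₀, ht₀⟩, x₀⟩ (A * r) (Tm * r ^ 2) (Tp * r ^ 2) hb ⟨t, ht⟩) ≤
        C * r ^ m * Real.exp (pointedNashEntropy h
          (fun r' v ↦ hflow.heatKernelFn hh hR t₀ x₀ (v, r')) m t₀ (t₀ - (Tm + α) * r ^ 2)) := by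
  classical
  -- the constants
  set Hm : ℝ := MetricFlow.concentrationConst m with hHm
  have hHm0 : 0 ≤ Hm := by
    have h3 : (3 : ℝ) ≤ m := by exact_mod_cast hm
    have h1 : 0 ≤ ((m : ℝ) - 1) * Real.pi ^ 2 / 2 :=
      div_nonneg (mul_nonneg (by linarith only [h3]) (sq_nonneg _)) zero_le_two
    rw [hHm, MetricFlow.concentrationConst]
    linarith only [h1]
  set Θ : ℝ := (Tm + max Tp 0) / α + 1 with hΘ
  have hΘ0 : 0 < Θ := by positivity
  set D : ℝ := max A 0 / Real.sqrt α + 2 * Real.sqrt (Hm * Θ) with hD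
  have hD0 : 0 ≤ D := by positivity
  set A₁ : ℝ := max D 1
  set E : ℝ := Real.exp ((m : ℝ) / 2 * Real.log ((Tm + α) / α) +
    Real.sqrt ((m : ℝ) / 2 + Λ) * Real.sqrt (Hm * Θ)) with hE
  obtain ⟨C₀, hC₀, core⟩ := exists_riemVolume_le_of_hCenters_near m hm hΛ hD0 hΘ0
  obtain ⟨C₈, C₂, hC₈, hC₂, H81⟩ := exists_riemVolume_ball_le_exp_pointedNashEntropy m hm hΛ
  set C₉ : ℝ := C₈ * Real.exp (C₂ * A₁ ^ 2) with hC₉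
  have hC₉0 : 0 < C₉ := by positivity
  refine ⟨(C₀ + C₉) * α ^ ((m : ℝ) / 2) * E, by positivity, ?_⟩
  intro M _ _ _ _ _ _ _ _ _ h cov a T hflow hh hR t₀ t r ht₀ ht hb hr hs₁a hs₀T Rmin hRmin hRΛ x₀
  -- notation
  set s₁ : ℝ := t₀ - (Tm + α) * r ^ 2 with hs₁
  set s₀ : ℝ := t₀ - Tm * r ^ 2 with hs₀
  set 𝒳 : MetricFlow (Icc a T) := ricciFlowMetricFlow hh hR Set.ordConnected_Icc hflow
  set S := 𝒳.pParabolicNhdSlice ⟨⟨t₀, ht₀⟩, x₀⟩ (A * r) (Tm * r ^ 2) (Tp * r ^ 2) hb ⟨t, ht⟩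
  set N₀ : ℝ := pointedNashEntropy h (fun r' v ↦ hflow.heatKernelFn hh hR t₀ x₀ (v, r')) m t₀ s₁
  have hRHS0 : 0 ≤ (C₀ + C₉) * α ^ ((m : ℝ) / 2) * E * r ^ m * Real.exp N₀ := by positivity
  -- the slice is empty unless `s₀ ≤ t ≤ t₀ + T⁺ r²`
  by_cases htime : s₀ ≤ t ∧ t ≤ t₀ + Tp * r ^ 2
  swap
  · have hS0 : S = ∅ :=
      eq_empty_of_forall_notMem fun y hy ↦ htime (MetricFlow.mem_pParabolicNhdSlice_iff.1 hy).1
    rw [hS0]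
    exact measureReal_empty.trans_le hRHS0
  obtain ⟨hts, htp⟩ := htime
  -- elementary facts about the times
  have hr2 : 0 < r ^ 2 := pow_pos hr 2
  have hρ2 : s₀ - s₁ = α * r ^ 2 := by rw [hs₀, hs₁]; ring
  have hρ2pos : 0 < s₀ - s₁ := by rw [hρ2]; positivity
  have hs₁₀ : s₁ < s₀ := sub_pos.1 hρ2pos
  have ht₀s₀ : t₀ - s₀ = Tm * r ^ 2 := by rw [hs₀]; ring
  have hs₀t₀ : s₀ ≤ t₀ := by nlinarith only [ht₀s₀, hTm, hr2]
  set ρ : ℝ := Real.sqrt (s₀ - s₁) with hρdef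
  have hρ0 : 0 < ρ := Real.sqrt_pos.2 hρ2pos
  have hρsq : ρ ^ 2 = s₀ - s₁ := Real.sq_sqrt hρ2pos.le
  have hρ : ρ = Real.sqrt α * r := by
    rw [hρdef, hρ2, Real.sqrt_mul hα.le, Real.sqrt_sq hr.le]
  have hΘρ : Θ * ρ ^ 2 = (Tm + max Tp 0) * r ^ 2 + α * r ^ 2 := by
    rw [hρsq, hρ2, hΘ]
    field_simp
  have hTp : Tp * r ^ 2 ≤ max Tp 0 * r ^ 2 := mul_le_mul_of_nonneg_right (le_max_left _ _) hr2.le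
  have hΘt₀ : t₀ - s₀ ≤ Θ * ρ ^ 2 := by
    rw [hΘρ, ht₀s₀]
    nlinarith only [le_max_right Tp 0, hr2, hα]
  have hΘt : t - s₀ ≤ Θ * ρ ^ 2 := by
    rw [hΘρ]
    nlinarith only [htp, ht₀s₀, hTp, hr2, hα]
  -- the scalar curvature budgets
  have hRmin₁ : ∀ y : M, Rmin ≤ (h s₁).scalarCurvatureWith (cov s₁) y :=
    fun y ↦ hRmin s₁ ⟨le_rfl, hs₁₀.le.trans hts⟩ y
  have hRΛ₁ : -Rmin * (s₀ - s₁) ≤ Λ := by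
    rcases le_or_gt 0 Rmin with h0 | h0
    · have h1 : 0 ≤ Rmin * (s₀ - s₁) := mul_nonneg h0 hρ2pos.le
      linarith only [h1, hΛ]
    · have h1 : -Rmin * (s₀ - s₁) ≤ -Rmin * (t - s₁) :=
        mul_le_mul_of_nonneg_left (by linarith only [hts]) (by linarith only [h0])
      exact h1.trans hRΛ
  -- `H_m`-concentration and an `H_m`-centre `z₀` of `(x₀, t₀)` at time `s₀`
  have hm0 : 0 < m := by omega
  have hH : 𝒳.IsHConcentrated Hm :=
    ricciFlowMetricFlow_isHConcentrated hm0 hh hR Set.ordConnected_Icc hflow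
  set sb : Icc a T := ⟨s₀, hb⟩
  obtain ⟨z₀, hz₀⟩ := hH.exists_isHCenter (s := sb) (t := ⟨t₀, ht₀⟩) hs₀t₀ x₀
  -- the entropy step: `exp(𝒩*_{s₁}(z₀, s₀)) ≤ E exp(𝒩*_{s₁}(x₀, t₀))`
  have hent : Real.exp (pointedNashEntropy h (fun r' v ↦ hflow.heatKernelFn hh hR s₀ z₀ (v, r'))
      m s₀ s₁) ≤ E * Real.exp N₀ := by
    have hvar : ∫⁻ w, (h s₀).edist (hR s₀) z₀ w ^ 2 ∂(heatKernelMeasure hh hR t₀ x₀ s₀) ≤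
        ENNReal.ofReal (Hm * (t₀ - s₀)) := hz₀.lintegral_edist_sq_le
    have h1 := kernelNashEntropy_le_of_lintegral_edist_sq_le hflow hh hR hm hs₁a hs₁₀ hs₀t₀ hs₀T
      ht₀.2 hRmin₁ x₀ z₀ (mul_nonneg hHm0 (sub_nonneg.2 hs₀t₀)) hvar
    have hquot : (t₀ - s₁) / (s₀ - s₁) = (Tm + α) / α := by
      rw [hρ2, show t₀ - s₁ = (Tm + α) * r ^ 2 by rw [hs₁]; ring]
      exact mul_div_mul_right _ _ hr2.ne'
    have hsq : Real.sqrt (Hm * (t₀ - s₀)) ≤ Real.sqrt (Hm * Θ) * ρ := by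
      have := ofReal_mul_rpow_half_le_ofReal_sqrt_mul hHm0 (sub_nonneg.2 hs₀t₀) hρ0.le hΘt₀
      rwa [ENNReal.ofReal_rpow_of_nonneg (mul_nonneg hHm0 (sub_nonneg.2 hs₀t₀)) (by norm_num),
        ← Real.sqrt_eq_rpow, ENNReal.ofReal_le_ofReal_iff (by positivity)] at this
    have hLρ : Real.sqrt ((m : ℝ) / (2 * (s₀ - s₁)) - Rmin) * ρ ≤ Real.sqrt ((m : ℝ) / 2 + Λ) := by
      refine sqrt_mul_sqrt_le_sqrt_of_le_div hρ2pos ?_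
      have e : (m : ℝ) / (2 * (s₀ - s₁)) * (s₀ - s₁) = (m : ℝ) / 2 := by
        field_simp
      rw [le_div_iff₀ hρ2pos, sub_mul, e]
      linarith only [hRΛ₁]
    have hL0 : 0 ≤ Real.sqrt ((m : ℝ) / (2 * (s₀ - s₁)) - Rmin) := Real.sqrt_nonneg _
    have h2 : Real.sqrt ((m : ℝ) / (2 * (s₀ - s₁)) - Rmin) * Real.sqrt (Hm * (t₀ - s₀)) ≤
        Real.sqrt ((m : ℝ) / 2 + Λ) * Real.sqrt (Hm * Θ) := by
      calc Real.sqrt ((m : ℝ) / (2 * (s₀ - s₁)) - Rmin) * Real.sqrt (Hm * (t₀ - s₀))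
          ≤ Real.sqrt ((m : ℝ) / (2 * (s₀ - s₁)) - Rmin) * (Real.sqrt (Hm * Θ) * ρ) :=
            mul_le_mul_of_nonneg_left hsq hL0
        _ = Real.sqrt ((m : ℝ) / (2 * (s₀ - s₁)) - Rmin) * ρ * Real.sqrt (Hm * Θ) := by ring
        _ ≤ Real.sqrt ((m : ℝ) / 2 + Λ) * Real.sqrt (Hm * Θ) :=
            mul_le_mul_of_nonneg_right hLρ (Real.sqrt_nonneg _)
    rw [hquot] at h1
    rw [hE, ← Real.exp_add]
    refine Real.exp_le_exp.2 ?_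
    linarith only [h1, h2]
  -- the `H_m`-centres of the points of `S` at time `s₀` are within `D ρ` of `z₀`
  have hP : (ENNReal.ofReal (Hm * (t₀ - s₀))) ^ (1 / 2 : ℝ) ≤
      ENNReal.ofReal (Real.sqrt (Hm * Θ) * ρ) :=
    ofReal_mul_rpow_half_le_ofReal_sqrt_mul hHm0 (sub_nonneg.2 hs₀t₀) hρ0.le hΘt₀
  have hQ : ENNReal.ofReal (A * r) ≤ ENNReal.ofReal (max A 0 / Real.sqrt α * ρ) := by
    refine ENNReal.ofReal_le_ofReal ?_
    have e : max A 0 / Real.sqrt α * ρ = max A 0 * r := by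
      rw [hρ, div_mul_eq_mul_div, mul_div_assoc, mul_div_cancel_left₀ r (Real.sqrt_pos.2 hα).ne']
    rw [e]
    exact mul_le_mul_of_nonneg_right (le_max_left _ _) hr.le
  have hPc : (ENNReal.ofReal (Hm * (t - s₀))) ^ (1 / 2 : ℝ) ≤
      ENNReal.ofReal (Real.sqrt (Hm * Θ) * ρ) :=
    ofReal_mul_rpow_half_le_ofReal_sqrt_mul hHm0 (sub_nonneg.2 hts) hρ0.le hΘt
  have hsum : ENNReal.ofReal (Real.sqrt (Hm * Θ) * ρ) +
      ENNReal.ofReal (max A 0 / Real.sqrt α * ρ) + ENNReal.ofReal (Real.sqrt (Hm * Θ) * ρ) =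
        ENNReal.ofReal (D * ρ) := by
    rw [← ENNReal.ofReal_add (by positivity) (by positivity),
      ← ENNReal.ofReal_add (by positivity) (by positivity)]
    congr 1
    rw [hD]
    ring
  have hdist : ∀ x ∈ S, ∀ z : 𝒳.Slice sb, 𝒳.IsHCenter Hm z x →
      edist z₀ z < ENNReal.ofReal (D * ρ) := by
    intro x hx z hz
    have hW : wassersteinW1 (𝒳.condKernel (t := ⟨t₀, ht₀⟩) x₀ sb) (𝒳.condKernel x sb) <
        ENNReal.ofReal (A * r) := (MetricFlow.mem_pParabolicNhdSlice_iff.1 hx).2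
    have hd := hz₀.edist_le_wassersteinW1_add hz
    have hP' : (ENNReal.ofReal (Hm * (((⟨t₀, ht₀⟩ : Icc a T) : ℝ) - (sb : ℝ)))) ^ (1 / 2 : ℝ) ≤
        ENNReal.ofReal (Real.sqrt (Hm * Θ) * ρ) := hP
    have hPc' : (ENNReal.ofReal (Hm * (((⟨t, ht⟩ : Icc a T) : ℝ) - (sb : ℝ)))) ^ (1 / 2 : ℝ) ≤
        ENNReal.ofReal (Real.sqrt (Hm * Θ) * ρ) := hPc
    refine hd.trans_lt ?_
    rw [← hsum]
    exact ENNReal.add_lt_add_of_lt_of_le (ne_top_of_le_ne_top ENNReal.ofReal_ne_top hPc')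
      (ENNReal.add_lt_add_of_le_of_lt (ne_top_of_le_ne_top ENNReal.ofReal_ne_top hP') hP'
        (hW.trans_le hQ)) hPc'
  -- the power of the scale
  have hpow : (s₀ - s₁) ^ ((m : ℝ) / 2) = α ^ ((m : ℝ) / 2) * r ^ m := by
    rw [hρ2, Real.mul_rpow hα.le hr2.le, sq_rpow_natCast_div_two hr.le]
  have hαE : 0 ≤ α ^ ((m : ℝ) / 2) * E := by positivity
  rcases hts.eq_or_lt with h0 | hs₀t
  · /- the base slice `t = s₀`: `S ⊆ B_{s₀}(z₀, A₁ ρ)` and Thm. 8.1 -/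
    set B : Set M := {y | (h s₀).edist (hR s₀) z₀ y < ENNReal.ofReal (A₁ * ρ)}
    have hvolB := H81 hflow hh hR hs₁a hs₁₀ hs₀T
      (fun s hs y ↦ hRmin s ⟨hs.1, hs.2.trans hts⟩ y) hRΛ₁ z₀ (le_max_right D 1)
    have hsub : ∀ x ∈ S, (x : M) ∈ B := by
      intro x hx
      have hW : wassersteinW1 (𝒳.condKernel (t := ⟨t₀, ht₀⟩) x₀ sb)
          (heatKernelMeasure (M := M) hh hR t x s₀) < ENNReal.ofReal (A * r) :=
        (MetricFlow.mem_pParabolicNhdSlice_iff.1 hx).2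
      rw [← h0, heatKernelMeasure_self] at hW
      haveI := 𝒳.isProbabilityMeasure_condKernel (t := ⟨t₀, ht₀⟩) (s := sb) x₀ hs₀t₀
      have hd : edist z₀ x < ENNReal.ofReal (A₁ * ρ) := by
        rw [← wassersteinW1_dirac_dirac]
        calc _ ≤ wassersteinW1 (Measure.dirac z₀) (𝒳.condKernel (t := ⟨t₀, ht₀⟩) x₀ sb) +
                wassersteinW1 (𝒳.condKernel (t := ⟨t₀, ht₀⟩) x₀ sb)
                  (Measure.dirac x) := wassersteinW1_triangle _ _ _
          _ < ENNReal.ofReal (Real.sqrt (Hm * Θ) * ρ) +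
                ENNReal.ofReal (max A 0 / Real.sqrt α * ρ) :=
              ENNReal.add_lt_add_of_le_of_lt
                (ne_top_of_le_ne_top ENNReal.ofReal_ne_top (hz₀.wassersteinW1_dirac_le.trans hP))
                (hz₀.wassersteinW1_dirac_le.trans hP) (hW.trans_le hQ)
          _ = ENNReal.ofReal ((Real.sqrt (Hm * Θ) + max A 0 / Real.sqrt α) * ρ) := by
              rw [← ENNReal.ofReal_add (by positivity) (by positivity)]
              congr 1
              ring
          _ ≤ ENNReal.ofReal (A₁ * ρ) := by
              refine ENNReal.ofReal_le_ofReal (mul_le_mul_of_nonneg_right ?_ hρ0.le)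
              have h1 : Real.sqrt (Hm * Θ) + max A 0 / Real.sqrt α ≤ D := by
                rw [hD]
                linarith only [Real.sqrt_nonneg (Hm * Θ)]
              exact h1.trans (le_max_left D 1)
      exact hd
    rw [← h0]
    haveI : IsFiniteMeasure (h s₀).riemVolume := ⟨(h s₀).riemVolume_univ_lt_top⟩
    have hQ0 : 0 ≤ C₉ * (s₀ - s₁) ^ ((m : ℝ) / 2) *
        Real.exp (pointedNashEntropy h (fun r' v ↦ hflow.heatKernelFn hh hR s₀ z₀ (v, r'))
          m s₀ s₁) := by positivity
    calc (h s₀).riemVolume.real S ≤ (h s₀).riemVolume.real B :=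
          measureReal_mono hsub (measure_ne_top _ _)
      _ ≤ C₉ * (s₀ - s₁) ^ ((m : ℝ) / 2) *
            Real.exp (pointedNashEntropy h (fun r' v ↦ hflow.heatKernelFn hh hR s₀ z₀ (v, r'))
              m s₀ s₁) := by
          rw [measureReal_def]
          refine (ENNReal.toReal_mono ENNReal.ofReal_ne_top hvolB).trans_eq ?_
          rw [ENNReal.toReal_ofReal (by positivity), hC₉]
      _ ≤ C₉ * (s₀ - s₁) ^ ((m : ℝ) / 2) * (E * Real.exp N₀) :=
          mul_le_mul_of_nonneg_left hent (by positivity)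
      _ = C₉ * (α ^ ((m : ℝ) / 2) * E) * r ^ m * Real.exp N₀ := by rw [hpow]; ring
      _ ≤ (C₀ + C₉) * (α ^ ((m : ℝ) / 2) * E) * r ^ m * Real.exp N₀ :=
          mul_le_mul_of_nonneg_right (mul_le_mul_of_nonneg_right
            (mul_le_mul_of_nonneg_right (by linarith only [hC₀]) hαE) (pow_nonneg hr.le m))
            (Real.exp_pos _).le
      _ = (C₀ + C₉) * α ^ ((m : ℝ) / 2) * E * r ^ m * Real.exp N₀ := by ring
  · /- `t > s₀`: the core `exists_riemVolume_le_of_hCenters_near` -/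
    have hSmeas : MeasurableSet S :=
      hH.measurableSet_pParabolicNhdSlice ⟨⟨t₀, ht₀⟩, x₀⟩ (A * r) (Tp * r ^ 2)
        (by positivity : (0 : ℝ) ≤ Tm * r ^ 2) hb ⟨t, ht⟩
    have hcen : ∀ x ∈ S, ∃ z : M,
        ∫⁻ w, (h s₀).edist (hR s₀) z w ^ 2 ∂(heatKernelMeasure hh hR t x s₀) ≤
          ENNReal.ofReal (Hm * (t - s₀)) ∧
        (h s₀).edist (hR s₀) z₀ z < ENNReal.ofReal (D * ρ) := by
      intro x hx
      obtain ⟨z, hz⟩ := hH.exists_isHCenter (s := sb) (t := ⟨t, ht⟩) hts x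
      exact ⟨z, hz.lintegral_edist_sq_le, hdist x hx z hz⟩
    have hΘt' : t - s₀ ≤ Θ * (s₀ - s₁) := by rw [← hρsq]; exact hΘt
    have hvol := core hflow hh hR hs₁a hs₁₀ hs₀t ht.2 hΘt' hRmin hRΛ z₀ hSmeas hcen
    calc (h t).riemVolume.real S
        ≤ C₀ * (s₀ - s₁) ^ ((m : ℝ) / 2) *
            Real.exp (pointedNashEntropy h (fun r' v ↦ hflow.heatKernelFn hh hR s₀ z₀ (v, r'))
              m s₀ s₁) := hvol
      _ ≤ C₀ * (s₀ - s₁) ^ ((m : ℝ) / 2) * (E * Real.exp N₀) :=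
          mul_le_mul_of_nonneg_left hent (by positivity)
      _ = C₀ * (α ^ ((m : ℝ) / 2) * E) * r ^ m * Real.exp N₀ := by rw [hpow]; ring
      _ ≤ (C₀ + C₉) * (α ^ ((m : ℝ) / 2) * E) * r ^ m * Real.exp N₀ :=
          mul_le_mul_of_nonneg_right (mul_le_mul_of_nonneg_right
            (mul_le_mul_of_nonneg_right (by linarith only [hC₉0]) hαE) (pow_nonneg hr.le m))
            (Real.exp_pos _).le
      _ = (C₀ + C₉) * α ^ ((m : ℝ) / 2) * E * r ^ m * Real.exp N₀ := by ring

/-- **Display (9.8) as printed**, for `T⁻ > 0`: the bound of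
`exists_riemVolume_pParabolicNhdSlice_le` with the entropy `𝒩_{x₀,t₀}(T⁻ r²) = 𝒩*_{s₀}(x₀, t₀)`
taken at the base time `s₀ = t₀ − T⁻ r²` of the `P*`-parabolic neighbourhood,

  `|S_t|_{g_t} ≤ C(m, Λ, A, T⁻, T⁺, α) rᵐ exp(𝒩_{x₀,t₀}(T⁻ r²))`,

from the previous theorem and `𝒩*_{s₁}(x₀, t₀) ≤ 𝒩*_{s₀}(x₀, t₀)` for `s₁ ≤ s₀ < t₀` (Prop. 5.2,
`kernelNashEntropy_mono`). [cite: Bamler2020Entropy, §9.1, arXiv v1 Thm. 35, (9.8); §5.1, Prop. 5.2] -/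
theorem exists_riemVolume_pParabolicNhdSlice_le_exp_kernelNashEntropy_baseTime (m : ℕ)
    (hm : 3 ≤ m) (A Tp : ℝ) {Λ Tm α : ℝ} (hΛ : 0 ≤ Λ) (hTm : 0 < Tm) (hα : 0 < α) :
    ∃ C : ℝ, 0 < C ∧ ∀ {M : Type*} [TopologicalSpace M]
      [ChartedSpace (EuclideanSpace ℝ (Fin m)) M]
      [IsManifold 𝓘(ℝ, EuclideanSpace ℝ (Fin m)) ∞ M] [T2Space M] [CompactSpace M]
      [SecondCountableTopology M] [MeasurableSpace M] [BorelSpace M] [ConnectedSpace M]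
      {h : ℝ → PseudoRiemannianMetric 𝓘(ℝ, EuclideanSpace ℝ (Fin m)) ∞ (EuclideanSpace ℝ (Fin m))
        (TangentSpace 𝓘(ℝ, EuclideanSpace ℝ (Fin m)) : M → Type _)}
      {cov : ℝ → CovariantDerivative 𝓘(ℝ, EuclideanSpace ℝ (Fin m)) (EuclideanSpace ℝ (Fin m))
        (TangentSpace 𝓘(ℝ, EuclideanSpace ℝ (Fin m)) : M → Type _)}
      {a T : ℝ} (hflow : IsRicciFlow h cov (Icc a T)) (hh : IsContMDiffFamilyOn ∞ h univ)
      (hR : ∀ r, (h r).IsRiemannian),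
      ∀ {t₀ t r : ℝ} (ht₀ : t₀ ∈ Icc a T) (ht : t ∈ Icc a T) (hb : t₀ - Tm * r ^ 2 ∈ Icc a T),
      0 < r → a < t₀ - (Tm + α) * r ^ 2 → t₀ - Tm * r ^ 2 < T →
      ∀ {Rmin : ℝ}, (∀ s ∈ Icc (t₀ - (Tm + α) * r ^ 2) t, ∀ z : M,
        Rmin ≤ (h s).scalarCurvatureWith (cov s) z) →
      -Rmin * (t - (t₀ - (Tm + α) * r ^ 2)) ≤ Λ → ∀ x₀ : M,
      (h t).riemVolume.real
          ((ricciFlowMetricFlow hh hR Set.ordConnected_Icc hflow).pParabolicNhdSlice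
            ⟨⟨t₀, ht₀⟩, x₀⟩ (A * r) (Tm * r ^ 2) (Tp * r ^ 2) hb ⟨t, ht⟩) ≤
        C * r ^ m * Real.exp (pointedNashEntropy h
          (fun r' v ↦ hflow.heatKernelFn hh hR t₀ x₀ (v, r')) m t₀ (t₀ - Tm * r ^ 2)) := by
  obtain ⟨C, hC, H⟩ := exists_riemVolume_pParabolicNhdSlice_le m hm A Tp hΛ hTm.le hα
  refine ⟨C, hC, ?_⟩
  intro M _ _ _ _ _ _ _ _ _ h cov a T hflow hh hR t₀ t r ht₀ ht hb hr hs₁a hs₀T Rmin hRmin hRΛ x₀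
  refine (H hflow hh hR ht₀ ht hb hr hs₁a hs₀T hRmin hRΛ x₀).trans ?_
  have hr2 : 0 < r ^ 2 := pow_pos hr 2
  have h12 : t₀ - (Tm + α) * r ^ 2 ≤ t₀ - Tm * r ^ 2 := by nlinarith only [hr2, hα]
  have h2 : t₀ - Tm * r ^ 2 < t₀ := by nlinarith only [hr2, hTm]
  have hC0 : 0 ≤ C * r ^ m := by positivity
  exact mul_le_mul_of_nonneg_left
    (Real.exp_le_exp.2 (kernelNashEntropy_mono hflow hh hR hm hs₁a h12 h2 ht₀.2 x₀)) hC0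

end Literature.Geometry.Riemannian

end
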